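import Mathlib.LinearAlgebra.Matrix.NonsingularInverse
import Mathlib.Data.Real.Basic
import Mathlib.Tactic.Linarith
import HarnessLib

/-!
# Simplex multipliers: the dual solution read off an optimal basis (Luenberger–Ye, §4.3–4.4)

[LY08] = D. G. Luenberger, Y. Ye, *Linear and Nonlinear Programming* [LuenbergerYe2008], chapter
"Duality" (Ch. 4 in the held copy `book:luenberger2008-linear-nonlinear-programming` and in the
Springer 2008 printing), §4.3 "Relations to the simplex procedure" and §4.4 "Sensitivity and
complementary slackness".

Setting (5)/(6): the primal `minimize cᵀx subject to Ax = b, x ≥ 0` with `A = [B, D]` partitioned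
into a nonsingular basis `B` (`m × m`) and the nonbasic columns `D` (`m × k`), costs `c = (c_B, c_D)`,
and the dual `maximize λᵀb subject to λᵀA ≤ cᵀ`, i.e. `λᵀB ≤ c_Bᵀ` and `λᵀD ≤ c_Dᵀ` blockwise.
The **simplex multipliers** of the basis are `λᵀ = c_BᵀB⁻¹` (`simplexMultiplier`).

Results recorded:
* `basis_transpose_mulVec_simplexMultiplier` — `λᵀB = c_Bᵀ` ((10a) of §4.5: the basic columns
  price out exactly);
* `reducedCost_eq` — the relative cost vector of §3.7, `r_Dᵀ = c_Dᵀ − c_BᵀB⁻¹D`, equals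
  `c_D − Dᵀλ` ("this λ vector can be used at every step to calculate the relative cost
  coefficients");
* `dual_feasible_iff_reducedCost_nonneg` — `λᵀD ≤ c_Dᵀ` iff `r_D ≥ 0`, hence
  `simplexMultiplier_dual_feasible`: an optimal basis (`r_D ≥ 0`) gives a dual feasible `λ`
  (`λᵀA = [c_Bᵀ, c_BᵀB⁻¹D] ≤ [c_Bᵀ, c_Dᵀ]`);
* `simplexMultiplier_dotProduct_rhs` — `λᵀb = c_BᵀB⁻¹b = c_Bᵀx_B` (equal objective values);
* the **Theorem of §4.3**: `simplexMultiplier_dual_optimal` (every dual feasible `μ` has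
  `μᵀb ≤ λᵀb`, given `x_B = B⁻¹b ≥ 0`) and `basic_primal_optimal` (every primal feasible
  `(x_B', x_D')` has `cᵀx' ≥ c_Bᵀx_B`, given `r_D ≥ 0`), so `λ` solves the dual and the optimal
  values agree (`optimal_values_eq`);
* §4.4 (8) **sensitivity**: `sensitivity_eq` — for `b ↦ b + Δb` with the basis unchanged,
  `Δz = c_BᵀB⁻¹Δb = λᵀΔb`.

Published results only (Lean placement rule): every public declaration carries its
`[cite: LuenbergerYe2008, §4.3/§4.4 …]` locator.
-/

namespace Literature.Analysis.Convex.SimplexMultipliers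

open Matrix

variable {m k : Type*} [Fintype m] [Fintype k] [DecidableEq m]

/-- The simplex multipliers of a basis `B` with basic costs `c_B`: `λᵀ = c_BᵀB⁻¹`, i.e.
`λ = (B⁻¹)ᵀc_B`. [cite: LuenbergerYe2008, §4.3 Simplex Multipliers, λᵀ = c_BᵀB⁻¹] -/
noncomputable def simplexMultiplier (B : Matrix m m ℝ) (cB : m → ℝ) : m → ℝ := (B⁻¹)ᵀ *ᵥ cB

/-- The basic columns price out exactly: `λᵀB = c_Bᵀ`, i.e. `Bᵀλ = c_B` (for `B` nonsingular).
[cite: LuenbergerYe2008, §4.3 display λᵀA = [λᵀB, λᵀD] = [c_Bᵀ, c_BᵀB⁻¹D]; §4.5 (10a)] -/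
theorem basis_transpose_mulVec_simplexMultiplier {B : Matrix m m ℝ} (hB : IsUnit B.det) (cB : m → ℝ) :
    Bᵀ *ᵥ simplexMultiplier B cB = cB := by
  unfold simplexMultiplier
  rw [mulVec_mulVec, ← transpose_mul, nonsing_inv_mul _ hB, transpose_one, one_mulVec]

/-- `λᵀa = c_Bᵀ(B⁻¹a)`: pricing out a column with the multipliers is the synthetic cost of the
column expressed in the basis. [cite: LuenbergerYe2008, §4.3 Simplex Multipliers ("pricing out")] -/
theorem simplexMultiplier_dotProduct (B : Matrix m m ℝ) (cB a : m → ℝ) :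
    simplexMultiplier B cB ⬝ᵥ a = cB ⬝ᵥ (B⁻¹ *ᵥ a) := by
  unfold simplexMultiplier
  rw [mulVec_transpose, dotProduct_comm, dotProduct_mulVec, dotProduct_comm]

omit [Fintype k] in
/-- The relative cost vector of the nonbasic columns, `r_Dᵀ = c_Dᵀ − c_BᵀB⁻¹D` (§3.7), is
`c_D − Dᵀλ`. [cite: LuenbergerYe2008, §4.3 display r_Dᵀ = c_Dᵀ − c_BᵀB⁻¹D] -/
theorem reducedCost_eq (B : Matrix m m ℝ) (D : Matrix m k ℝ) (cB : m → ℝ) (cD : k → ℝ) :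
    cD - (B⁻¹ * D)ᵀ *ᵥ cB = cD - Dᵀ *ᵥ simplexMultiplier B cB := by
  unfold simplexMultiplier
  rw [transpose_mul, ← mulVec_mulVec]

omit [Fintype k] in
/-- Dual feasibility on the nonbasic block is exactly nonnegativity of the relative costs:
`λᵀD ≤ c_Dᵀ ↔ r_D ≥ 0`. [cite: LuenbergerYe2008, §4.3 ("since r_D is nonnegative in each
component we have c_BᵀB⁻¹D ≤ c_Dᵀ")] -/
theorem dual_feasible_iff_reducedCost_nonneg (B : Matrix m m ℝ) (D : Matrix m k ℝ) (cB : m → ℝ)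
    (cD : k → ℝ) :
    (∀ j, (Dᵀ *ᵥ simplexMultiplier B cB) j ≤ cD j) ↔ ∀ j, 0 ≤ (cD - (B⁻¹ * D)ᵀ *ᵥ cB) j := by
  rw [reducedCost_eq]
  simp only [Pi.sub_apply, sub_nonneg]

omit [Fintype k] in
/-- An optimal basis (`r_D ≥ 0`) yields dual feasible multipliers:
`λᵀA = [c_Bᵀ, c_BᵀB⁻¹D] ≤ [c_Bᵀ, c_Dᵀ] = cᵀ`, stated blockwise.
[cite: LuenbergerYe2008, §4.3 display λᵀA ≤ cᵀ ("λ is feasible for the dual")] -/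
theorem simplexMultiplier_dual_feasible {B : Matrix m m ℝ} (hB : IsUnit B.det) (D : Matrix m k ℝ)
    (cB : m → ℝ) (cD : k → ℝ) (hr : ∀ j, 0 ≤ (cD - (B⁻¹ * D)ᵀ *ᵥ cB) j) :
    (∀ i, (Bᵀ *ᵥ simplexMultiplier B cB) i ≤ cB i) ∧
      ∀ j, (Dᵀ *ᵥ simplexMultiplier B cB) j ≤ cD j := by
  refine ⟨fun i => ?_, (dual_feasible_iff_reducedCost_nonneg B D cB cD).2 hr⟩
  rw [basis_transpose_mulVec_simplexMultiplier hB]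

/-- Equal objective values: `λᵀb = c_BᵀB⁻¹b = c_Bᵀx_B`.
[cite: LuenbergerYe2008, §4.3 display λᵀb = c_BᵀB⁻¹b = c_Bᵀx_B] -/
theorem simplexMultiplier_dotProduct_rhs (B : Matrix m m ℝ) (cB b : m → ℝ) :
    simplexMultiplier B cB ⬝ᵥ b = cB ⬝ᵥ (B⁻¹ *ᵥ b) :=
  simplexMultiplier_dotProduct B cB b

/-- **Theorem (§4.3), dual side.** If the basic solution `x_B = B⁻¹b` is feasible (`x_B ≥ 0`), then
every `μ` that is dual feasible on the basic columns (`μᵀB ≤ c_Bᵀ`) has `μᵀb ≤ c_Bᵀx_B = λᵀb`; so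
the simplex multipliers of an optimal basis solve the dual (6) (Lemma 1 of §4.2 applied to the
basic part). [cite: LuenbergerYe2008, §4.3 Theorem (λᵀ = c_BᵀB⁻¹ is an optimal solution to the dual)] -/
theorem simplexMultiplier_dual_optimal {B : Matrix m m ℝ} (hB : IsUnit B.det) (cB b : m → ℝ)
    (hx : ∀ i, 0 ≤ (B⁻¹ *ᵥ b) i) {μ : m → ℝ} (hμ : ∀ i, (Bᵀ *ᵥ μ) i ≤ cB i) :
    μ ⬝ᵥ b ≤ simplexMultiplier B cB ⬝ᵥ b := by
  rw [simplexMultiplier_dotProduct_rhs]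
  have hb : b = B *ᵥ (B⁻¹ *ᵥ b) := by
    rw [mulVec_mulVec, mul_nonsing_inv _ hB, one_mulVec]
  calc μ ⬝ᵥ b = μ ⬝ᵥ (B *ᵥ (B⁻¹ *ᵥ b)) := by rw [← hb]
    _ = (Bᵀ *ᵥ μ) ⬝ᵥ (B⁻¹ *ᵥ b) := by rw [dotProduct_mulVec, mulVec_transpose]
    _ ≤ cB ⬝ᵥ (B⁻¹ *ᵥ b) := by
        unfold dotProduct
        exact Finset.sum_le_sum fun i _ => mul_le_mul_of_nonneg_right (hμ i) (hx i)

/-- **Theorem (§4.3), primal side.** If the basis prices out optimally (`r_D ≥ 0`), then every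
primal feasible point `x' = (x_B', x_D')` (`Bx_B' + Dx_D' = b`, `x' ≥ 0`) costs at least
`c_Bᵀx_B = λᵀb`: `cᵀx' ≥ λᵀAx' = λᵀb`. [cite: LuenbergerYe2008, §4.3 Theorem (the optimal values of
both problems are equal); §4.2 Lemma 1] -/
theorem basic_primal_optimal {B : Matrix m m ℝ} (hB : IsUnit B.det) (D : Matrix m k ℝ)
    (cB b : m → ℝ) (cD : k → ℝ) (hr : ∀ j, 0 ≤ (cD - (B⁻¹ * D)ᵀ *ᵥ cB) j)
    {xB' : m → ℝ} {xD' : k → ℝ} (hfeas : B *ᵥ xB' + D *ᵥ xD' = b) (hxD : ∀ j, 0 ≤ xD' j) :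
    cB ⬝ᵥ (B⁻¹ *ᵥ b) ≤ cB ⬝ᵥ xB' + cD ⬝ᵥ xD' := by
  have hD := (dual_feasible_iff_reducedCost_nonneg B D cB cD).2 hr
  have h1 : simplexMultiplier B cB ⬝ᵥ b =
      cB ⬝ᵥ xB' + (Dᵀ *ᵥ simplexMultiplier B cB) ⬝ᵥ xD' := by
    rw [← hfeas, dotProduct_add, dotProduct_mulVec, dotProduct_mulVec, ← mulVec_transpose,
      ← mulVec_transpose, basis_transpose_mulVec_simplexMultiplier hB]
  have h2 : (Dᵀ *ᵥ simplexMultiplier B cB) ⬝ᵥ xD' ≤ cD ⬝ᵥ xD' := by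
    unfold dotProduct
    exact Finset.sum_le_sum fun j _ => mul_le_mul_of_nonneg_right (hD j) (hxD j)
  rw [← simplexMultiplier_dotProduct_rhs, h1]
  linarith

/-- **Theorem (§4.3), equality of optimal values.** With `x_B = B⁻¹b ≥ 0` and `r_D ≥ 0` the common
value is `c_Bᵀx_B = λᵀb`: it is the primal minimum and the dual maximum.
[cite: LuenbergerYe2008, §4.3 Theorem] -/
theorem optimal_values_eq {B : Matrix m m ℝ} (hB : IsUnit B.det) (D : Matrix m k ℝ) (cB b : m → ℝ)
    (cD : k → ℝ) (hx : ∀ i, 0 ≤ (B⁻¹ *ᵥ b) i) (hr : ∀ j, 0 ≤ (cD - (B⁻¹ * D)ᵀ *ᵥ cB) j) :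
    IsLeast {z | ∃ xB' : m → ℝ, ∃ xD' : k → ℝ, B *ᵥ xB' + D *ᵥ xD' = b ∧ (∀ i, 0 ≤ xB' i) ∧
        (∀ j, 0 ≤ xD' j) ∧ z = cB ⬝ᵥ xB' + cD ⬝ᵥ xD'} (simplexMultiplier B cB ⬝ᵥ b) ∧
      IsGreatest {w | ∃ μ : m → ℝ, (∀ i, (Bᵀ *ᵥ μ) i ≤ cB i) ∧ (∀ j, (Dᵀ *ᵥ μ) j ≤ cD j) ∧
        w = μ ⬝ᵥ b} (simplexMultiplier B cB ⬝ᵥ b) := by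
  refine ⟨⟨?_, ?_⟩, ⟨?_, ?_⟩⟩
  · refine ⟨B⁻¹ *ᵥ b, 0, ?_, hx, fun _ => le_rfl, ?_⟩
    · rw [mulVec_zero, add_zero, mulVec_mulVec, mul_nonsing_inv _ hB, one_mulVec]
    · rw [dotProduct_zero, add_zero, simplexMultiplier_dotProduct_rhs]
  · rintro z ⟨xB', xD', hfeas, -, hxD, rfl⟩
    rw [simplexMultiplier_dotProduct_rhs]
    exact basic_primal_optimal hB D cB b cD hr hfeas hxD
  · obtain ⟨h1, h2⟩ := simplexMultiplier_dual_feasible hB D cB cD hr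
    exact ⟨simplexMultiplier B cB, h1, h2, rfl⟩
  · rintro w ⟨μ, hμB, -, rfl⟩
    exact simplexMultiplier_dual_optimal hB cB b hx hμB

/-- §4.4 (8) **sensitivity**: if `b` is changed to `b + Δb` and the optimal basis does not change,
the new basic solution is `x_B + Δx_B` with `Δx_B = B⁻¹Δb`, and the optimal cost changes by
`Δz = c_BᵀΔx_B = λᵀΔb`. [cite: LuenbergerYe2008, §4.4 (8)] -/
theorem sensitivity_eq (B : Matrix m m ℝ) (cB b Δb : m → ℝ) :
    cB ⬝ᵥ (B⁻¹ *ᵥ (b + Δb)) - cB ⬝ᵥ (B⁻¹ *ᵥ b) = simplexMultiplier B cB ⬝ᵥ Δb := by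
  rw [mulVec_add, dotProduct_add, add_sub_cancel_left, simplexMultiplier_dotProduct]

/-- §4.4: `λ_j` is the marginal price of `b_j` — changing `b_j` alone by `Δb_j` changes the optimal
value by `λ_jΔb_j`. [cite: LuenbergerYe2008, §4.4 ("if b_j is changed to b_j + Δb_j the value of the
optimal solution changes by λ_jΔb_j")] -/
theorem sensitivity_single (B : Matrix m m ℝ) (cB b : m → ℝ) (j : m) (δ : ℝ) :
    cB ⬝ᵥ (B⁻¹ *ᵥ (b + Pi.single j δ)) - cB ⬝ᵥ (B⁻¹ *ᵥ b) = simplexMultiplier B cB j * δ := by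
  rw [sensitivity_eq, dotProduct_single]

end Literature.Analysis.Convex.SimplexMultipliers
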